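import Summits.AtomisticToContinuum.BoseEinsteinCondensation.Theorems.BECInsertionCorrectorCorrectorClosureRemovalEnergyBudgetRemoval
import Summits.AtomisticToContinuum.BoseEinsteinCondensation.Theorems.BECInsertionCorrectorCorrectorClosureGroundStateFrame
import HarnessLib

/-!
# The removal energy budget in ground-state representation (registered stub
# `stub_removalEnergyBudget` of line `zero-mode-removal-susceptibility`, shared removal module of
# line `volume-homotopy-sum-rule-domination`; crux `BECInsertionCorrector.CorrectorClosure`,
# item stmt-AtomisticToContinuum-12058)

Supports (does not close) stmt-AtomisticToContinuum-12058: lands the registered stub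
`stub_removalEnergyBudget` (skeleton `Cruxes/CorrectorClosure/Lines/zero_mode_removal_susceptibility.lean`,
stub B = first brick of stub S6 `stub_removalFidelity` of `Lines/volume_homotopy_sum_rule_domination.lean`).

**Statement.** In a box `L > 0` with bounded periodised potential `v^per`, let `Θ₀` (`N` bodies) and
`Φ₀` (`N + 1` bodies) be continuous strictly positive torus Feynman–Kac ground states
(`IsPeriodicGroundStateFK`) and `G(X) = ∫_{[0,L)³} Φ₀(x, X) dx` the zero-mode REMOVAL amplitude. Then
the removal ratio `g = G/Θ₀` is a periodic test function and its `Θ₀`-Dirichlet energy obeys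
`𝓔_{Θ₀}(g, g) = ∫ |∇g|² Θ₀² ≤ (E₀(N+1) − E₀(N)) ∫ G²`; in operator words
`⟨G, (H_N − E₀(N)) G⟩ ≤ μ_{N+1} ‖G‖²`, `μ_{N+1} = E₀(N+1) − E₀(N)`.

**Proof.** (i) Both ground states are `C¹` (`stub_periodicGroundStateRegularity`; for `N = 0` the
`N`-body configuration space is a point), read in `ℂ` they are periodic trial states
(`exists_trialState_of_fk`) attaining the finite ground-state energies
(`periodicEnergy_le_of_isPeriodicGroundStateFK` and the variational principle); `G` is a periodic test
function by differentiation under the cell integral (`reb_isPeriodicTest_removal`), hence so is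
`g = G/Θ₀`. (ii) The removal budget `∫|∇G|² + ∫ V_N G² ≤ E₀(N+1) ∫ G²` is `reb_removal_firstMoment`
(the `(N+1)`-body Euler–Lagrange equation paired with `G∘tail`, the impurity–bath term dropped by
positivity). (iii) Davies' ground-state representation with respect to `Θ₀`: the `N`-body
Euler–Lagrange equation (`tilt_el_all`) tested on `ζ = g²` reads
`∫ ∇Θ₀·∇(g²Θ₀) + ∫ V_N G² = E₀(N) ∫ G²`, and the pointwise Jacobi identity
`|∇(gΘ₀)|² = ∇Θ₀·∇(g²Θ₀) + |∇g|² Θ₀²` (`gradDot_mul_self_eq`) gives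
`𝓔_{Θ₀}(g, g) = ∫|∇G|² + ∫ V_N G² − E₀(N) ∫ G² ≤ (E₀(N+1) − E₀(N)) ∫ G²`.

## References

* [Davies1989] E. B. Davies, *Heat kernels and spectral theory* (1989), §4.2 Thm 4.2.1
  (ground-state transform).
* [ReedSimonIV1978] M. Reed, B. Simon, *Methods of Modern Mathematical Physics IV* (1978), §XIII.1
  (Rayleigh–Ritz).
-/

noncomputable section

namespace Summit.AtomisticToContinuum.BoseEinsteinCondensation.Theorems.CorrectorClosure.ZeroModeRemovalSusceptibility

open MeasureTheory Filter Matrix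
open scoped ENNReal NNReal
open Literature.MathematicalPhysics.QuantumManyBody.BoseGas
open Summit.AtomisticToContinuum.BoseEinsteinCondensation.Theorems.CorrectorClosure.GeometricMeanCorrector
  (tilt_el_all exists_trialState_of_fk realPos_of_ofReal)
open Summit.AtomisticToContinuum.BoseEinsteinCondensation.Cruxes.HardCoreExtension.ThirdLawCurrentFloor
  (stub_periodicGroundStateRegularity)
open Summit.AtomisticToContinuum.BoseEinsteinCondensation.Theorems.TorusGroundState
  (periodicEnergy_le_of_isPeriodicGroundStateFK)
open Summit.AtomisticToContinuum.BoseEinsteinCondensation.Cruxes.StaticResponseBound.UvThomsonForceWave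
  (gradDot_mul_self_eq)

/-- **Stub B `stub_removalEnergyBudget` — the removal energy budget in ground-state representation
(FIRST MOMENT of the zero-mode removal state).** In a box `L > 0` with bounded `v^per`, for continuous
positive torus FK ground states `Θ₀` (`N` bodies) and `Φ₀` (`N+1` bodies) and the removal amplitude
`G = ∫_cell Φ₀(x,·)dx`, the removal ratio `g = G/Θ₀` is a periodic test function (`C¹`, lattice
periodic) and its `Θ₀`-Dirichlet energy is at most the chemical potential times the removal mass:
`𝓔_{Θ₀}(g,g) = ∫|∇g|²Θ₀² ≤ (E₀(N+1) − E₀(N)) ∫ G²` — in operator words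
`⟨G,(H_N − E₀(N))G⟩ ≤ μ_{N+1}‖G‖²`: the normalised removal state `a₀Φ₀/‖a₀Φ₀‖` is an `N`-body trial
state of energy `≤ E₀(N+1)`. Proof: (i) `Θ₀, Φ₀ ∈ C¹` (`stub_periodicGroundStateRegularity`; `N = 0`:
a function on a point), read in `ℂ` they are periodic trial states attaining the finite ground-state
energies (`exists_trialState_of_fk`, `periodicEnergy_le_of_isPeriodicGroundStateFK`); `G ∈ C¹` by
differentiation under the cell integral and lattice periodic (`reb_isPeriodicTest_removal`), hence
`g = G/Θ₀` is a periodic test function; (ii) the removal budget `∫|∇G|² + ∫V_N G² ≤ E₀(N+1)∫G²`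
(`reb_removal_firstMoment`: the `(N+1)`-body Euler–Lagrange equation paired with `G∘tail`, Fubini over
the removed particle's cell, the impurity–bath term `∫ G ∑ⱼ v^per Φ₀ ≥ 0` dropped); (iii) Davies'
ground-state representation w.r.t. `Θ₀`: the `N`-body Euler–Lagrange equation (`tilt_el_all`) tested
on `ζ = g²` and the pointwise Jacobi identity `|∇(gΘ₀)|² = ∇Θ₀·∇(g²Θ₀) + |∇g|²Θ₀²` give
`𝓔_{Θ₀}(g,g) = ∫|∇G|² + ∫V_N G² − E₀(N)∫G²`. Subtract.
[cite: Davies1989, §4.2 Thm 4.2.1 (ground-state transform)]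
[cite: ReedSimonIV1978, §XIII.1 (Rayleigh–Ritz)] -/
theorem stub_removalEnergyBudget (v : ℝ → ℝ≥0∞) (hv : IsRepulsiveFiniteRange v) (N : ℕ) (L : ℝ)
    (hL : 0 < L) (hb : ∃ C : ℝ≥0, ∀ x, periodizedPotential v L x ≤ C)
    (Θ₀ : Config N → ℝ) (hΘ : IsPeriodicGroundStateFK v L Θ₀) (hΘc : Continuous Θ₀) (hΘp : ∀ X, 0 < Θ₀ X)
    (Φ₀ : Config (N + 1) → ℝ) (hΦ : IsPeriodicGroundStateFK v L Φ₀) (hΦc : Continuous Φ₀)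
    (hΦp : ∀ X, 0 < Φ₀ X)
    (G : Config N → ℝ) (hG : G = fun X => ∫ x in cell L, Φ₀ (vecCons x X)) :
    IsPeriodicTest L (fun X => G X / Θ₀ X) ∧
      dirichletFormW L Θ₀ (fun X => G X / Θ₀ X) (fun X => G X / Θ₀ X) ≤
        ((periodicGroundStateEnergy v (N + 1) L).toReal - (periodicGroundStateEnergy v N L).toReal) *
          ∫ X in cellN N L, G X ^ 2 := by
  have hvm : Measurable v := hv.1
  obtain ⟨C, hC⟩ := hb
  -- (i) regularity: both Feynman–Kac ground states are `C¹`
  have hΘC1 : ContDiff ℝ 1 Θ₀ := by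
    rcases Nat.eq_zero_or_pos N with rfl | hN
    · have h : Θ₀ = fun _ => Θ₀ 0 := funext fun X => congrArg Θ₀ (Subsingleton.elim X 0)
      rw [h]
      exact contDiff_const
    · exact stub_periodicGroundStateRegularity N L v hN hL hvm ⟨C, hC⟩ Θ₀ hΘ
  have hΦC1 : ContDiff ℝ 1 Φ₀ :=
    stub_periodicGroundStateRegularity (N + 1) L v (Nat.le_add_left 1 N) hL hvm ⟨C, hC⟩ Φ₀ hΦ
  -- read in `ℂ`: periodic trial states attaining the finite ground-state energies
  obtain ⟨Θ, hΘψ⟩ := exists_trialState_of_fk hΘ hΘC1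
  obtain ⟨Φ, hΦψ⟩ := exists_trialState_of_fk hΦ hΦC1
  have hEΘ : periodicEnergy v Θ = periodicGroundStateEnergy v N L :=
    le_antisymm (periodicEnergy_le_of_isPeriodicGroundStateFK hL hvm hC hΘ hΘC1 Θ hΘψ)
      (periodicGroundStateEnergy_le v Θ)
  have hEΦ : periodicEnergy v Φ = periodicGroundStateEnergy v (N + 1) L :=
    le_antisymm (periodicEnergy_le_of_isPeriodicGroundStateFK hL hvm hC hΦ hΦC1 Φ hΦψ)
      (periodicGroundStateEnergy_le v Φ)
  have hΘfin : periodicEnergy v Θ ≠ ⊤ := by rw [hEΘ]; exact hΘ.energy_ne_top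
  have hΦfin : periodicEnergy v Φ ≠ ⊤ := by rw [hEΦ]; exact hΦ.energy_ne_top
  have hΘreal : ∀ X, Θ.ψ X = (‖Θ.ψ X‖ : ℂ) := fun X => (realPos_of_ofReal hΘp Θ hΘψ X).1
  have hΦreal : ∀ Z, Φ.ψ Z = (‖Φ.ψ Z‖ : ℂ) := fun Z => (realPos_of_ofReal hΦp Φ hΦψ Z).1
  have hΘn : ∀ X, ‖Θ.ψ X‖ = Θ₀ X := fun X => by
    have h1 : Θ.ψ X = ((Θ₀ X : ℝ) : ℂ) := by rw [hΘψ]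
    rw [h1, Complex.norm_real, Real.norm_of_nonneg (hΘp X).le]
  have hΦn : ∀ Z, ‖Φ.ψ Z‖ = Φ₀ Z := fun Z => by
    have h1 : Φ.ψ Z = ((Φ₀ Z : ℝ) : ℂ) := by rw [hΦψ]
    rw [h1, Complex.norm_real, Real.norm_of_nonneg (hΦp Z).le]
  have hG' : ∀ X, G X = ∫ x in cell L, Φ₀ (vecCons x X) := fun X => by rw [hG]
  -- (ii) the removal budget `∫|∇G|² + ∫ V_N G² ≤ E₀(N+1) ∫ G²`
  have hbudget := reb_removal_firstMoment hvm hC hL Φ hΦreal hEΦ hΦfin hΦn hΦp hG'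
  -- `G` and `g = G/Θ₀` are periodic test functions
  have hGt : IsPeriodicTest L G := reb_isPeriodicTest_removal hL ⟨hΦC1, hΦ.periodic⟩ hG'
  obtain ⟨g, hg⟩ : ∃ g : Config N → ℝ, g = fun X => G X / Θ₀ X := ⟨_, rfl⟩
  have hgt : IsPeriodicTest L g := by
    rw [hg]
    exact ⟨hGt.1.div hΘC1 fun X => (hΘp X).ne', fun X i k => by simp only [hGt.2, hΘ.periodic]⟩
  suffices hD : dirichletFormW L Θ₀ g g ≤
      ((periodicGroundStateEnergy v (N + 1) L).toReal - (periodicGroundStateEnergy v N L).toReal) *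
        ∫ X in cellN N L, G X ^ 2 by
    rw [hg] at hgt hD; exact ⟨hgt, hD⟩
  have hgd : Differentiable ℝ g := hgt.differentiable
  have hΘd : Differentiable ℝ Θ₀ := hΘC1.differentiable one_ne_zero
  have hgΘ : ∀ X, g X * Θ₀ X = G X := fun X => by rw [hg]; exact div_mul_cancel₀ _ (hΘp X).ne'
  have hg2 : ∀ X, g X ^ 2 * Θ₀ X ^ 2 = G X ^ 2 := fun X => by rw [← mul_pow, hgΘ]
  -- (iii) the `N`-body Euler–Lagrange equation of `Θ₀` tested on `ζ = g²`
  have hζC : ContDiff ℝ 1 fun Y => g Y ^ 2 := hgt.1.pow 2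
  have hζper : IsLatticePeriodic L fun Y => g Y ^ 2 := fun X i k => by
    show g (X + _) ^ 2 = g X ^ 2
    rw [hgt.2]
  have hel : (∫ X in cellN N L, gradDot Θ₀ (fun Y => g Y ^ 2 * Θ₀ Y) X) +
      (∫ X in cellN N L, (periodicInteraction v L X).toReal * G X ^ 2) =
      (periodicGroundStateEnergy v N L).toReal * ∫ X in cellN N L, G X ^ 2 := by
    have h := tilt_el_all (M := N) hvm hΘreal hEΘ hΘfin hζC hζper
    rw [hEΘ] at h
    simp only [hΘn] at h
    have e2 : ∫ X in cellN N L, (periodicInteraction v L X).toReal * g X ^ 2 * Θ₀ X ^ 2 =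
        ∫ X in cellN N L, (periodicInteraction v L X).toReal * G X ^ 2 :=
      integral_congr_ae (ae_of_all _ fun X => by dsimp only; rw [mul_assoc, hg2])
    have e3 : ∫ X in cellN N L, g X ^ 2 * Θ₀ X ^ 2 = ∫ X in cellN N L, G X ^ 2 :=
      integral_congr_ae (ae_of_all _ fun X => hg2 X)
    rw [e2, e3] at h
    exact h
  -- Davies' ground-state representation: `|∇g|²Θ₀² = |∇G|² − ∇Θ₀·∇(g²Θ₀)` pointwise
  have hGfun : (fun Y => g Y * Θ₀ Y) = G := funext hgΘ
  have hpt : ∀ X, gradDot g g X * Θ₀ X ^ 2 =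
      gradDot G G X - gradDot Θ₀ (fun Y => g Y ^ 2 * Θ₀ Y) X := by
    intro X
    have h := gradDot_mul_self_eq (hgd X) (hΘd X)
    rw [hGfun] at h
    linarith
  have iGG : IntegrableOn (fun X => gradDot G G X) (cellN N L) :=
    integrableOn_cellN (continuous_gradDot hGt.1 hGt.1) L
  have iΘζ : IntegrableOn (fun X => gradDot Θ₀ (fun Y => g Y ^ 2 * Θ₀ Y) X) (cellN N L) :=
    integrableOn_cellN (continuous_gradDot hΘC1 (hζC.mul hΘC1)) L
  have hDir : dirichletFormW L Θ₀ g g = (∫ X in cellN N L, gradDot G G X) -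
      ∫ X in cellN N L, gradDot Θ₀ (fun Y => g Y ^ 2 * Θ₀ Y) X := by
    rw [dirichletFormW, integral_congr_ae (ae_of_all _ hpt), integral_sub iGG iΘζ]
  rw [hDir]
  linarith

end Summit.AtomisticToContinuum.BoseEinsteinCondensation.Theorems.CorrectorClosure.ZeroModeRemovalSusceptibility

end
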